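import Summits.NavierStokesRegularity.NavierStokesRegularity.Theorems.TypeILiouvilleTypeIliouvilleLInertialGaugeClassical
import Summits.NavierStokesRegularity.NavierStokesRegularity.Theorems.TypeILiouvilleTypeIliouvilleLStubOseenConstBoost
import Literature.Analysis.FluidPDE.BoundedMildAncientPressureGauge
import HarnessLib

/-!
# The sublinear-pressure gauge IS print's class (W1 ⟨stmt-NavierStokesRegularity-1222⟩ tooling)

Support file (theorems only, no definitions, no named facts). The W1 custodians' scope-gap binder
C′ (HorizonTower sketch v5, `IsSublinearAtInfinity (p t)` for every `t < 0`) asks that the slice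
pressures of a classical member `(u, p)` of the duality-form class be sublinear at infinity. By the
drift-regularity theorem `inertialGauge_of_smooth` and the gauge equivalence
`pressure_sublinear_iff_frameAccel_eq_zero_of_contDiffOn` (Seregin 2014 Lemma 6.5 in the inertial
frame), the frame acceleration then vanishes on the whole life span, so the frame path is AFFINE,
`ξ(t) = ξ₀ + t c₁`, and `u` is the CONSTANT Galilean boost (`stub_oseen_const_boost`, KNSS 2009 §1)
composed with a fixed translation of its inertial representative: `u` itself solves the Oseen
integral (KNSS-mild) equation between all pairs of negative times.

* ★ `pressure_sublinear_iff_frameAccel_eq_zero_of_classical` — the «sublinear pressure gauge ⟺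
  inertial frame» equivalence `pressure_sublinear_iff_frameAccel_eq_zero_of_contDiffOn` (Literature
  `BoundedMildAncientPressureGauge`, Seregin 2014 Lemma 6.5 in the inertial frame) made
  UNCONDITIONAL for every classical `(u, p)` on `t < 0` with `u` in the duality-form class: there is
  a smooth frame path `ξ` on `t < 0` with `u = V(·, · − ξ) + ξ′`, `V` bounded KNSS-mild, and for
  every `t < 0` the slice pressure `p(t, ·)` is sublinear at infinity iff `ξ″(t) = 0`.
* ★ `oseenMild_of_sublinear_pressure` — classical `(u, p)` on `t < 0`, `u` bounded ancient mild in
  duality form, every slice pressure sublinear ⇒ `u` is KNSS/Oseen-mild (print's class).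
* ★ `sublinear_pressure_iff_oseenMild` — for classical members of the duality-form class:
  «every slice pressure is sublinear at infinity» ⟺ «`u` is KNSS-mild» (the converse is the
  tree's `pressure_sublinear_of_bounded_oseenMild`, Seregin 2014 Def. 6.3 / Lemma 6.5).

So the gauge binder of C′ selects EXACTLY print's class of bounded ancient mild solutions inside
the duality-form class: on it the whole KNSS 2009 / Seregin machinery (uniform derivative bounds,
pressure representation `p = R_iR_j(u_iu_j)` up to `κ(t)`) is available by name.

## References

* G. Koch, N. Nadirashvili, G. Seregin, V. Šverák, Acta Math. 203 (2009), §1 p. 3 (Galilean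
  frames, parasitic solutions), §4 (i)–(ii). [KochNadirashviliSereginSverak2009]
* G. Seregin, *Lecture Notes on Regularity Theory for the Navier–Stokes Equations*, World
  Scientific 2014, §6.3 Def. 6.3, Lemma 6.5. [Seregin2014]

WHAT THIS IS NOT: not a claim about NS regularity, (L), or ⟨1222⟩.
-/

-- the summit and its single problem share the name (D-0017 nested layout)
set_option linter.dupNamespace false

noncomputable section

open MeasureTheory Filter Set Function Metric
open scoped Topology ENNReal ContDiff RealInnerProductSpace

namespace Summit.NavierStokesRegularity.NavierStokesRegularity.Theorems

namespace TypeIliouvilleL.SublinearGauge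

/-- **A path with vanishing second derivative on `(−∞, 0)` is affine there**: if `ξ` is `C^∞` on
`t < 0` and `ξ″ ≡ 0` on `t < 0`, then `ξ′ ≡ c₁` and `ξ(t) = ξ₀ + t • c₁` on `t < 0` with
`c₁ = ξ′(−1)`, `ξ₀ = ξ(−1) + c₁`. -/
theorem affine_of_deriv_deriv_eq_zero {ξ : ℝ → EuclideanSpace ℝ (Fin 3)}
    (hξ : ContDiffOn ℝ ∞ ξ (Iio 0)) (hacc : ∀ t < 0, deriv (deriv ξ) t = 0) :
    (∀ t < 0, deriv ξ t = deriv ξ (-1)) ∧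
      ∀ t < 0, ξ t = (ξ (-1) + deriv ξ (-1)) + t • deriv ξ (-1) := by
  have h1 : (-1 : ℝ) ∈ Iio (0 : ℝ) := by norm_num
  obtain ⟨hdiff, hξ'⟩ := (contDiffOn_infty_iff_deriv_of_isOpen isOpen_Iio).1 hξ
  have hdiff' : DifferentiableOn ℝ (deriv ξ) (Iio 0) :=
    ((contDiffOn_infty_iff_deriv_of_isOpen isOpen_Iio).1 hξ').1
  have hconst : ∀ t < 0, deriv ξ t = deriv ξ (-1) := fun t ht =>
    isOpen_Iio.is_const_of_deriv_eq_zero isPreconnected_Iio hdiff' (fun τ hτ => hacc τ hτ) ht h1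
  refine ⟨hconst, fun t ht => ?_⟩
  -- `g(t) = ξ t − t • c₁` has zero derivative on `(−∞, 0)`
  set c₁ := deriv ξ (-1) with hc₁
  have hgd : DifferentiableOn ℝ (fun τ => ξ τ - τ • c₁) (Iio 0) :=
    hdiff.sub ((differentiableOn_id).smul_const c₁)
  have hg' : (Iio (0 : ℝ)).EqOn (deriv fun τ => ξ τ - τ • c₁) 0 := by
    intro τ hτ
    have hξτ : DifferentiableAt ℝ ξ τ := (hdiff τ hτ).differentiableAt (Iio_mem_nhds hτ)
    have hsτ : DifferentiableAt ℝ (fun σ : ℝ => σ • c₁) τ := differentiableAt_id.smul_const c₁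
    show deriv (fun σ => ξ σ - σ • c₁) τ = 0
    rw [deriv_fun_sub hξτ hsτ, deriv_smul_const differentiableAt_id]
    simp only [deriv_id'', one_smul, hconst τ hτ, sub_self]
  have hg := isOpen_Iio.is_const_of_deriv_eq_zero isPreconnected_Iio hgd hg' ht h1
  -- `ξ t − t • c₁ = ξ(−1) + c₁`
  have : ξ t - t • c₁ = ξ (-1) + c₁ := by
    rw [hg, neg_one_smul, sub_neg_eq_add]
  rw [← this, sub_add_cancel]

end TypeIliouvilleL.SublinearGauge

open TypeIliouvilleL.InertialGauge Literature.Analysis Literature.Analysis.FluidPDE in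
/-- ★ **SUBLINEAR PRESSURE GAUGE ⟺ INERTIAL FRAME, UNCONDITIONALLY FOR CLASSICAL MEMBERS OF THE
DUALITY-FORM CLASS.** Let `(u, p)` be a classical solution of Navier–Stokes (`ν = 1`, no force) on
`t < 0` with `u` a bounded ancient mild solution in duality form. Then there is a frame path `ξ`,
`C^∞` on `t < 0`, such that `V(t, y) = u(t, y + ξ t) − ξ′(t)` is a bounded KNSS-mild ancient
solution (`inertialGauge_of_smooth`), and for EVERY `t < 0`:
the slice pressure `p(t, ·)` is sublinear at infinity (`∀ ε > 0, ∃ R, ∀ x, R ≤ ‖x‖ →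
|p t x| ≤ ε‖x‖`, the W1 custodians' `IsSublinearAtInfinity (p t)`) IF AND ONLY IF `ξ″(t) = 0`
(Literature `pressure_sublinear_iff_frameAccel_eq_zero_of_contDiffOn`: Seregin 2014 Lemma 6.5 in
the inertial frame + extended Galilean covariance). «Sublinear pressure gauge = inertial frame»,
with no regularity hypothesis on the drift left. -/
theorem pressure_sublinear_iff_frameAccel_eq_zero_of_classical
    (u : ℝ → EuclideanSpace ℝ (Fin 3) → EuclideanSpace ℝ (Fin 3))
    (p : ℝ → EuclideanSpace ℝ (Fin 3) → ℝ)
    (hcl : Literature.Analysis.FluidPDE.IsClassicalNSSolutionOn (Set.Iio 0) 1 0 u p)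
    (hu : Literature.Analysis.FluidPDE.IsBoundedAncientMildSolution 1 u) :
    ∃ ξ : ℝ → EuclideanSpace ℝ (Fin 3), ContDiffOn ℝ ∞ ξ (Set.Iio 0) ∧
      (∃ M : ℝ, ∀ t < 0, ∀ y, ‖u t (y + ξ t) - deriv ξ t‖ ≤ M) ∧
      (∀ s t : ℝ, s < t → t < 0 → ∀ y, u t (y + ξ t) - deriv ξ t =
        Literature.Analysis.UnboundedOperators.heatExtension
            (fun z => u s (z + ξ s) - deriv ξ s) (t - s) y -
          Literature.Analysis.FluidPDE.oseenDuhamel 1 s (fun τ z => u τ (z + ξ τ) - deriv ξ τ)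
            (fun τ z => u τ (z + ξ τ) - deriv ξ τ) t y) ∧
      ∀ t < 0, ((∀ ε : ℝ, 0 < ε → ∃ R : ℝ, ∀ x : EuclideanSpace ℝ (Fin 3), R ≤ ‖x‖ →
          |p t x| ≤ ε * ‖x‖) ↔ deriv (deriv ξ) t = 0) := by
  obtain ⟨ξ, hξ, M, hbd, -, -, hmild⟩ := inertialGauge_of_smooth u hu hcl.smooth_velocity
  exact ⟨ξ, hξ, ⟨M, hbd⟩, hmild,
    pressure_sublinear_iff_frameAccel_eq_zero_of_contDiffOn M u p ξ hcl hξ hbd hmild⟩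

open TypeIliouvilleL.SublinearGauge TypeIliouvilleL.InertialGauge Literature.Analysis
  Literature.Analysis.FluidPDE in
/-- ★ **THE SUBLINEAR-PRESSURE GAUGE PUTS A CLASSICAL MEMBER OF THE DUALITY CLASS IN PRINT'S CLASS.**
Let `(u, p)` be classical on `t < 0` (ν = 1, no force) with `u` a bounded ancient mild solution in
duality form, and suppose every slice pressure `p(t, ·)`, `t < 0`, is sublinear at infinity. Then
`u` itself solves the Oseen integral (KNSS-mild) equation `u(t) = e^{(t−s)Δ}u(s) − B¹ₛ(u,u)(t)`
pointwise for all `s < t < 0`, and its slices are weakly divergence free: `u` is a bounded ancient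
MILD solution of print's class (KNSS 2009 §4 (i)). Proof: `ξ″ ≡ 0` on `t < 0` by
`pressure_sublinear_iff_frameAccel_eq_zero_of_contDiffOn` applied to the smooth frame of
`inertialGauge_of_smooth`; so `ξ(t) = ξ₀ + t c₁` (`affine_of_deriv_deriv_eq_zero`) and
`u(t, x) = W(t, x − ξ₀)` with `W` the constant boost by `−c₁` of the inertial representative,
KNSS-mild by `stub_oseen_const_boost`; translate back (`heatExtension_comp_add_right_apply`,
`oseenDuhamel_comp_add_right`). -/
theorem oseenMild_of_sublinear_pressure
    (u : ℝ → EuclideanSpace ℝ (Fin 3) → EuclideanSpace ℝ (Fin 3))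
    (p : ℝ → EuclideanSpace ℝ (Fin 3) → ℝ)
    (hcl : Literature.Analysis.FluidPDE.IsClassicalNSSolutionOn (Set.Iio 0) 1 0 u p)
    (hu : Literature.Analysis.FluidPDE.IsBoundedAncientMildSolution 1 u)
    (hsub : ∀ t < 0, ∀ ε : ℝ, 0 < ε → ∃ R : ℝ, ∀ x : EuclideanSpace ℝ (Fin 3), R ≤ ‖x‖ →
      |p t x| ≤ ε * ‖x‖) :
    (∀ t < 0, Literature.Analysis.FluidPDE.IsWeaklyDivFree (u t)) ∧
      ∀ s t : ℝ, s < t → t < 0 → ∀ x, u t x =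
        Literature.Analysis.UnboundedOperators.heatExtension (u s) (t - s) x -
          Literature.Analysis.FluidPDE.oseenDuhamel 1 s u u t x := by
  obtain ⟨ξ, hξ, M, hbd, hVc, hVdiv, hmild⟩ := inertialGauge_of_smooth u hu hcl.smooth_velocity
  have hiff := pressure_sublinear_iff_frameAccel_eq_zero_of_contDiffOn M u p ξ hcl hξ hbd hmild
  have hacc : ∀ t < 0, deriv (deriv ξ) t = 0 := fun t ht => (hiff t ht).1 (hsub t ht)
  obtain ⟨hc₁, hξt⟩ := affine_of_deriv_deriv_eq_zero hξ hacc
  set c₁ : EuclideanSpace ℝ (Fin 3) := deriv ξ (-1) with hc₁_def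
  set ξ₀ : EuclideanSpace ℝ (Fin 3) := ξ (-1) + deriv ξ (-1) with hξ₀_def
  -- the inertial representative and its constant boost by `−c₁`
  set V : ℝ → EuclideanSpace ℝ (Fin 3) → EuclideanSpace ℝ (Fin 3) :=
    fun t y => u t (y + ξ t) - deriv ξ t with hV
  obtain ⟨-, -, hWdiv, hWmild⟩ := stub_oseen_const_boost V (-c₁) hVc ⟨M, hbd⟩ hVdiv hmild
  -- `W(t, y) = V(t, y − t c₁) + c₁ = u(t, y + ξ₀)` for `t < 0`
  have hW : ∀ t < 0, (fun y => V t (y + t • -c₁) - -c₁) = fun y => u t (y + ξ₀) := by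
    intro t ht
    funext y
    simp only [hV]
    rw [hc₁ t ht, hξt t ht, smul_neg, sub_neg_eq_add, sub_add_cancel]
    congr 1
    abel
  refine ⟨fun t ht => ?_, fun s t hst ht x => ?_⟩
  · -- weak divergence-freeness transports along the fixed translation
    have h1 : IsWeaklyDivFree fun y => u t (y + ξ₀) := by
      have h := hWdiv t ht
      simp only at h
      rwa [hW t ht] at h
    have h2 := h1.comp_add_right' (-ξ₀)
    simpa only [neg_add_cancel_right] using h2
  · have hs : s < 0 := hst.trans ht
    have hWt : ∀ y, V t (y + t • -c₁) - -c₁ = u t (y + ξ₀) := fun y => congrFun (hW t ht) y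
    have hWs : (fun y => V s (y + s • -c₁) - -c₁) = fun y => u s (y + ξ₀) := hW s hs
    have key := hWmild s t hst ht (x - ξ₀)
    simp only at key
    rw [hWt, hWs, sub_add_cancel] at key
    rw [key, heatExtension_comp_add_right_apply (u s) ξ₀, sub_add_cancel]
    congr 1
    have hτ : ∀ τ ∈ Ioo s t, (fun t y => V t (y + t • -c₁) - -c₁) τ = (fun τ y => u τ (y + ξ₀)) τ :=
      fun τ hτ => hW τ (hτ.2.trans ht)
    rw [oseenDuhamel_congr_Ioo hτ hτ, oseenDuhamel_comp_add_right, sub_add_cancel]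

open Literature.Analysis Literature.Analysis.FluidPDE in
/-- ★ **SUBLINEAR PRESSURE GAUGE ⟺ PRINT'S CLASS**, for classical members of the duality-form
class. Let `(u, p)` be classical on `t < 0` (ν = 1, no force) with `u` a bounded ancient mild
solution in duality form. Then: every slice pressure `p(t, ·)` (`t < 0`) is sublinear at infinity
IF AND ONLY IF `u` solves the Oseen integral (KNSS-mild) equation between all pairs of negative
times. (⇒ `oseenMild_of_sublinear_pressure`; ⇐ the tree's `pressure_sublinear_of_bounded_oseenMild`,
Seregin 2014 Def. 6.3 / Lemma 6.5.) The scope-gap binder C′ of the W1 custodians therefore selects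
exactly print's class. -/
theorem sublinear_pressure_iff_oseenMild
    (u : ℝ → EuclideanSpace ℝ (Fin 3) → EuclideanSpace ℝ (Fin 3))
    (p : ℝ → EuclideanSpace ℝ (Fin 3) → ℝ)
    (hcl : Literature.Analysis.FluidPDE.IsClassicalNSSolutionOn (Set.Iio 0) 1 0 u p)
    (hu : Literature.Analysis.FluidPDE.IsBoundedAncientMildSolution 1 u) :
    (∀ t < 0, ∀ ε : ℝ, 0 < ε → ∃ R : ℝ, ∀ x : EuclideanSpace ℝ (Fin 3), R ≤ ‖x‖ →
        |p t x| ≤ ε * ‖x‖) ↔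
      ∀ s t : ℝ, s < t → t < 0 → ∀ x, u t x =
        Literature.Analysis.UnboundedOperators.heatExtension (u s) (t - s) x -
          Literature.Analysis.FluidPDE.oseenDuhamel 1 s u u t x := by
  refine ⟨fun hsub => (oseenMild_of_sublinear_pressure u p hcl hu hsub).2, fun hmild => ?_⟩
  obtain ⟨M, hM⟩ := hu.2
  exact pressure_sublinear_of_bounded_oseenMild M u p (fun t ht x => hM t ht x)
    hcl.smooth_velocity.continuousOn hmild (fun t ht => hcl.divFree t ht) hcl

end Summit.NavierStokesRegularity.NavierStokesRegularity.Theorems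

end
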